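import Summits.NavierStokesRegularity.NavierStokesRegularity.Theorems.EfficiencyFloorProductionEfficiencyDecayScalarBarrier
import HarnessLib

/-!
# Crux `EfficiencyFloor.ProductionEfficiencyDecay` (stmt-NavierStokesRegularity-22866): the first factor `¬LerayRateBlowup` of
# the crux is not reachable from the scalar enstrophy budget either — the exactly-Leray-rate budget triple in the energy class

Helper file (`--supports stmt-NavierStokesRegularity-22866`; def-free; imports only the sibling barrier
`…ProductionEfficiencyDecayScalarBarrier`, p830537). The landed factorisation of the crux is `PED ↔ ¬LerayRateBlowup ∧ U`
(`…FrequentDepletion`). The sibling barrier (p830537) shows the UPGRADE factor U is not a consequence of any scalar functional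
inequality among `Z, Pal, S` (cubic law, energy class, palinstrophy-ratio budget, mean law). This file records the same for
the FIRST factor with the simplest witness — Leray's self-similar rate itself: for every `c > 0`, `ν > 0`,

  `Z = μ²/√(1−t)`, `Pal = μ²/(√(1−t))³`, `S = (Ż + 2ν·Pal)/2`, `μ = (1/4 + ν)/c`

satisfies every scalar clause of the registered stub `stub_depletionGivenBudget` (`0 < Z`, `0 ≤ Pal`,
`HasDerivAt Z (2S − 2ν·Pal)`, `|S| ≤ c·Z^{3/4}·Pal^{3/4}`), blow-up, the ENERGY CLASS `∫₀ˢ Z ≤ 2μ²`, the ratio budget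
`∫₀ˢ Pal/Z² ≤ 2/μ²`, the QUARTER LAW `Z ≤ μ²/√(1−t)` (the conclusion of the residual stmt-1574 for this triple) — and violates both
the pointwise law (`Ż/Z³ ≡ 1/(2μ⁴)`) and the MEAN law the route's `closes` consumes (`Z⁻²/(1−t) ≡ μ⁻⁴`) (`scalarLerayRate`).
Together with p830537 / p830627: at the scalar level each of `¬LerayRateBlowup`, `U`, and `EnstrophyQuarterLaw` is independent
of the budget information the registered skeletons carry; all three need spatial Navier–Stokes input.

HONEST FRAMING: explicit real functions; nothing about Navier–Stokes is asserted (in particular NOT that a Leray-rate blow-up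
exists); stmt-22866, stmt-1574 and NS regularity stay OPEN; no registered stub is closed. [folklore]
-/

-- the problem directory repeats the summit name (`NavierStokesRegularity/NavierStokesRegularity`)
set_option linter.dupNamespace false

noncomputable section

namespace Summit.NavierStokesRegularity.NavierStokesRegularity.Theorems

namespace ProductionEfficiencyDecay

namespace ScalarBarrier

open Set Filter Topology Real MeasureTheory intervalIntegral

/-- Derivative of Leray's rate `t ↦ 1/√(1−t)`: `1/(2(√(1−t))³)`, `t < 1`. [folklore] -/
theorem hasDerivAt_lerayModel {t : ℝ} (ht : t < 1) :
    HasDerivAt (fun s : ℝ => 1 / Real.sqrt (1 - s)) (1 / (2 * Real.sqrt (1 - t) ^ 3)) t := by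
  have hpos : 0 < 1 - t := sub_pos.2 ht
  have h1 : HasDerivAt (fun s : ℝ => 1 - s) (-1) t := by
    simpa using (hasDerivAt_id t).const_sub 1
  have hw : HasDerivAt (fun s : ℝ => Real.sqrt (1 - s)) ((-1) / (2 * Real.sqrt (1 - t))) t :=
    h1.sqrt hpos.ne'
  have hwne : Real.sqrt (1 - t) ≠ 0 := (Real.sqrt_pos.2 hpos).ne'
  refine ((hasDerivAt_const t (1 : ℝ)).div hw hwne).congr_deriv ?_
  field_simp
  ring

/-- Antiderivative: `t ↦ −2√(1−t)` has derivative `1/√(1−t)`, `t < 1`. [folklore] -/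
theorem hasDerivAt_lerayPrim {t : ℝ} (ht : t < 1) :
    HasDerivAt (fun s : ℝ => -2 * Real.sqrt (1 - s)) (1 / Real.sqrt (1 - t)) t := by
  have hpos : 0 < 1 - t := sub_pos.2 ht
  have h1 : HasDerivAt (fun s : ℝ => 1 - s) (-1) t := by
    simpa using (hasDerivAt_id t).const_sub 1
  have hwne : Real.sqrt (1 - t) ≠ 0 := (Real.sqrt_pos.2 hpos).ne'
  refine ((h1.sqrt hpos.ne').const_mul (-2)).congr_deriv ?_
  field_simp

/-- `∫₀ˢ dt/√(1−t) = 2 − 2√(1−s) ≤ 2` for `s ∈ [0,1)`. [folklore] -/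
theorem integral_lerayModel_le {s : ℝ} (hs : s ∈ Ico (0 : ℝ) 1) :
    ∫ t in (0 : ℝ)..s, (1 / Real.sqrt (1 - t)) ≤ 2 := by
  have hlt : ∀ x ∈ uIcc (0 : ℝ) s, x < 1 := fun x hx => by
    rw [uIcc_of_le hs.1] at hx; exact hx.2.trans_lt hs.2
  have hcont : ContinuousOn (fun t : ℝ => (1 / Real.sqrt (1 - t))) (uIcc 0 s) := fun x hx =>
    (hasDerivAt_lerayModel (hlt x hx)).continuousAt.continuousWithinAt
  rw [integral_eq_sub_of_hasDerivAt (fun x hx => hasDerivAt_lerayPrim (hlt x hx)) hcont.intervalIntegrable]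
  simp only [sub_zero, Real.sqrt_one]
  nlinarith [Real.sqrt_nonneg (1 - s)]

/-- **The Leray-rate budget triple.** For every `c > 0`, `ν > 0` there are real functions `Z, Pal, S, D` on `[0,1)` with
every scalar clause of the registered stub `stub_depletionGivenBudget` (`0 < Z`, `0 ≤ Pal`, `HasDerivAt Z D`,
`D = 2S − 2ν·Pal`, `|S| ≤ c·Z^{3/4}·Pal^{3/4}`), blow-up, the ENERGY CLASS, the palinstrophy-ratio budget and the QUARTER LAW
`Z ≤ K/√(1−t)` — which violate the pointwise efficiency law AND the mean law `Z(s)⁻² ≤ ε(1−s)` (both for `ε < μ⁻⁴/2`).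
Witness `Z = μ²/√(1−t)`, `μ = (1/4 + ν)/c`. Explicit real functions; nothing about Navier–Stokes is asserted. [folklore] -/
theorem scalarLerayRate (c ν : ℝ) (hc : 0 < c) (hν : 0 < ν) :
    ∃ Z P S D : ℝ → ℝ,
      (∀ t ∈ Ico (0 : ℝ) 1, 0 < Z t ∧ 0 ≤ P t ∧ HasDerivAt Z (D t) t ∧ D t = 2 * S t - 2 * ν * P t ∧
          |S t| ≤ c * Z t ^ (3 / 4 : ℝ) * P t ^ (3 / 4 : ℝ)) ∧
      (∀ N : ℝ, ∃ t₁ ∈ Ico (0 : ℝ) 1, ∀ t ∈ Ico t₁ 1, N ≤ Z t) ∧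
      (∃ E : ℝ, ∀ s ∈ Ico (0 : ℝ) 1, ∫ t in (0 : ℝ)..s, Z t ≤ E) ∧
      (∃ E' : ℝ, ∀ s ∈ Ico (0 : ℝ) 1, ∫ t in (0 : ℝ)..s, P t / Z t ^ 2 ≤ E') ∧
      (∃ K : ℝ, ∀ t ∈ Ico (0 : ℝ) 1, Z t ≤ K / Real.sqrt (1 - t)) ∧
      ¬ (∀ ε : ℝ, 0 < ε → ∃ t₁ ∈ Ico (0 : ℝ) 1, ∀ t ∈ Ico t₁ 1, D t ≤ ε * Z t ^ 3) ∧
      ¬ (∀ ε : ℝ, 0 < ε → ∃ t₁ ∈ Ico (0 : ℝ) 1, ∀ s ∈ Ico t₁ 1, (Z s)⁻¹ ^ 2 ≤ ε * (1 - s)) := by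
  obtain ⟨μ, hμ, hμc⟩ : ∃ μ : ℝ, 0 < μ ∧ c * μ = 1 / 4 + ν :=
    ⟨(1 / 4 + ν) / c, by positivity, by field_simp⟩
  have hμ2 : 0 ≤ μ ^ 2 := sq_nonneg μ
  refine ⟨fun t => μ ^ 2 * (1 / Real.sqrt (1 - t)), fun t => μ ^ 2 * (1 / Real.sqrt (1 - t)) ^ 3,
    fun t => (μ ^ 2 * (1 / (2 * Real.sqrt (1 - t) ^ 3)) + 2 * ν * (μ ^ 2 * (1 / Real.sqrt (1 - t)) ^ 3)) / 2, fun t => μ ^ 2 * (1 / (2 * Real.sqrt (1 - t) ^ 3)),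
    ?_, ?_, ?_, ?_, ?_, ?_, ?_⟩
  · -- the scalar clauses of the registered stub
    intro t ht
    beta_reduce
    have hD := (hasDerivAt_lerayModel ht.2).const_mul (μ ^ 2)
    obtain ⟨-, -, hwpos, -, -, -⟩ := basic ht
    set w : ℝ := Real.sqrt (1 - t) with hw_def
    have hx : 0 < 1 / w := by positivity
    have hx3 : 0 ≤ (1 / w) ^ 3 := by positivity
    refine ⟨by positivity, by positivity, hD, by ring, ?_⟩
    rw [mul_assoc c, rpow_budget hμ hx.le]
    have hkey : c * (μ ^ 3 * (1 / w) ^ 3) = μ ^ 2 * ((1 / 4 + ν) * (1 / w) ^ 3) := by rw [← hμc]; ring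
    have hS : (μ ^ 2 * (1 / (2 * w ^ 3)) + 2 * ν * (μ ^ 2 * (1 / w) ^ 3)) / 2 =
        μ ^ 2 * ((1 / 4 + ν) * (1 / w) ^ 3) := by
      field_simp
      ring
    rw [hkey, hS, abs_of_nonneg (by positivity)]
  · -- blow-up
    intro N
    rcases le_or_gt N 0 with hN | hN
    · refine ⟨0, ⟨le_rfl, zero_lt_one⟩, fun t ht => hN.trans ?_⟩
      obtain ⟨-, -, hwpos, -, -, -⟩ := basic ⟨ht.1, ht.2⟩
      beta_reduce
      positivity
    have hr : 0 < (μ ^ 2 / N) ^ 2 := by positivity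
    refine ⟨max 0 (1 - (μ ^ 2 / N) ^ 2), ⟨le_max_left _ _, max_lt zero_lt_one (by linarith)⟩,
      fun t ht => ?_⟩
    have ht' : t ∈ Ico (0 : ℝ) 1 := ⟨(le_max_left _ _).trans ht.1, ht.2⟩
    obtain ⟨-, -, hwpos, -, -, -⟩ := basic ht'
    have hle : 1 - t ≤ (μ ^ 2 / N) ^ 2 := by linarith [(le_max_right _ _).trans ht.1]
    have hw : Real.sqrt (1 - t) ≤ μ ^ 2 / N := by
      rw [← Real.sqrt_sq (by positivity : (0 : ℝ) ≤ μ ^ 2 / N)]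
      exact Real.sqrt_le_sqrt hle
    beta_reduce
    rw [mul_one_div, le_div_iff₀ hwpos]
    calc N * Real.sqrt (1 - t) ≤ N * (μ ^ 2 / N) := mul_le_mul_of_nonneg_left hw hN.le
      _ = μ ^ 2 := by field_simp
  · -- energy class
    refine ⟨2 * μ ^ 2, fun s hs => ?_⟩
    rw [intervalIntegral.integral_const_mul]
    nlinarith [integral_lerayModel_le hs, sq_nonneg μ]
  · -- palinstrophy-ratio budget
    refine ⟨2 / μ ^ 2, fun s hs => ?_⟩
    have heq : EqOn (fun t : ℝ => μ ^ 2 * (1 / Real.sqrt (1 - t)) ^ 3 / (μ ^ 2 * (1 / Real.sqrt (1 - t))) ^ 2)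
        (fun t : ℝ => (1 / μ ^ 2) * (1 / Real.sqrt (1 - t))) (uIcc 0 s) := by
      intro t ht
      rw [uIcc_of_le hs.1] at ht
      obtain ⟨-, -, hwpos, -, -, -⟩ := basic ⟨ht.1, ht.2.trans_lt hs.2⟩
      simp only
      field_simp
    rw [integral_congr heq, intervalIntegral.integral_const_mul]
    rw [show 2 / μ ^ 2 = 1 / μ ^ 2 * 2 by ring]
    exact mul_le_mul_of_nonneg_left (integral_lerayModel_le hs) (by positivity)
  · -- the quarter law HOLDS (Leray's rate exactly)
    exact ⟨μ ^ 2, fun t ht => by beta_reduce; rw [mul_one_div]⟩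
  · -- the pointwise efficiency law fails (`Ż/Z³ ≡ 1/(2μ⁴)`)
    intro h
    obtain ⟨t₁, ht₁, hlaw⟩ := h (1 / (4 * μ ^ 4)) (by positivity)
    have hlt := hlaw t₁ ⟨le_rfl, ht₁.2⟩
    simp only at hlt
    obtain ⟨-, -, hwpos, -, -, -⟩ := basic ht₁
    set w : ℝ := Real.sqrt (1 - t₁) with hw_def
    have h1 : 1 / (4 * μ ^ 4) * (μ ^ 2 * (1 / w)) ^ 3 = μ ^ 2 * (1 / (4 * w ^ 3)) := by
      field_simp
    have h2 : μ ^ 2 * (1 / (4 * w ^ 3)) < μ ^ 2 * (1 / (2 * w ^ 3)) :=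
      mul_lt_mul_of_pos_left (one_div_lt_one_div_of_lt (by positivity) (by nlinarith [pow_pos hwpos 3]))
        (pow_pos hμ 2)
    linarith
  · -- the MEAN law fails too (`Z⁻² = (1−t)/μ⁴`)
    intro h
    obtain ⟨t₁, ht₁, hlaw⟩ := h (1 / (2 * μ ^ 4)) (by positivity)
    have hlt := hlaw t₁ ⟨le_rfl, ht₁.2⟩
    simp only at hlt
    obtain ⟨h1, -, hwpos, -, hw2, -⟩ := basic ht₁
    set w : ℝ := Real.sqrt (1 - t₁) with hw_def
    rw [← hw2, inv_pow] at hlt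
    have h3 : (μ ^ 2 * (1 / w)) ^ 2 = μ ^ 4 / w ^ 2 := by
      field_simp
    rw [h3, inv_div] at hlt
    have h4 : 1 / (2 * μ ^ 4) * w ^ 2 < w ^ 2 / μ ^ 4 := by
      rw [div_mul_eq_mul_div, one_mul, div_lt_div_iff_of_pos_left (pow_pos hwpos 2) (by positivity) (by positivity)]
      nlinarith [pow_pos hμ 4]
    linarith

end ScalarBarrier

end ProductionEfficiencyDecay

end Summit.NavierStokesRegularity.NavierStokesRegularity.Theorems

end
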